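import Literature.MathematicalPhysics.QuantumFieldTheory.Balaban1983to89.T4AxialGaugeSmallField
import Literature.MathematicalPhysics.QuantumFieldTheory.Balaban1983to89.B15BasicStep

/-!
# `Balaban1983to89.B15Ineq183AxialGauge` — T. Bałaban, *Large field renormalization. I. The basic step of the 𝐑 operation*, Commun. Math. Phys. **122** (1989) 175–202 [Balaban1989LargeFieldI], p. 197, the bound (1.83) *"|V_Λ(b) − 1| < O(1)B₅M⁶ε_k for b ⊂ Λ^{(k)}"* — PROVED from its printed inputs (the regularity (1.78) of Proposition 1 on the parallelepiped `Λ` and the axial gauge), by name, in both bond-field carriers of the tree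

statement-level skeleton of published theorems with citation tags; proofs where landed; nothing here is a claim about the Yang–Mills mass gap

PDF held: `paper:balaban1989-cmp122-large-field-i` (journal page = PDF page + 174; p. 197 = PDF p. 23, pp. 194–195 = PDF
pp. 20–21, p. 192 = PDF p. 18; text layer re-read for this file).

WHAT IS REPRODUCED (mega-formalization `lit-balaban`, HOME `run/shared/lean/pub/lit-balaban/`, Phase-2 seat p26, generation 5;
SKELETON row **B15.Eq1.83** (r12), typed leaf `B15.BasicStep.Ineq183 dev C B₅ M ε_k := dev < C·B₅·M⁶·ε_k`; referee ref-5).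
P. 194, Proposition 1: *"An element of the orbit is a minimum of the function, and is denoted by V_Λ = V_Λ(V_k⌈Z∩Λᶜ). It
satisfies the regularity condition |V_Λ(∂p′) − 1| < B₅M⁵ε for p′ ∈ Λ. (1.78)"*.  P. 192, (1.73): *"Λ = (Ω^{~4}_{k₀+1})ᶜ ∩ Z.
This domain, obtained by adding one layer of M-cubes to Z″_k, is also a union of M-cubes, and by the condition (i) it is a
rectangular parallelepiped contained in a cube of the size 100M."*  P. 197, ll. 2–5, verbatim: *"The configuration
M_k(U₀) = V_Λ satisfies the regularity condition (1.78). We fix for it the axial gauge in Λ^{(k)}, hence the field V_Λ is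
small inside Λ^{(k)}. More precisely, it satisfies the bound  |V_Λ(b) − 1| < O(1)B₅M⁶ε_k  for b ⊂ Λ^{(k)}. (1.83)"*.

THE PROOF (the printed sentence, made quantitative).  `Λ^{(k)}` is a box `[lo, hi]` of the unit lattice `T^{(k)}_1` with at
most `D + 1 ≤ 100M + 1` sites per direction; in the axial gauge rooted at the corner `lo` (direction order of
`B7Prop1Explicit.treeWord`, the convention of [Balaban1985Averaging] pp. 24–25 used throughout the b07/b08 files) the tree
bonds are `= 1` and every other bond `⟨x, x + e_μ⟩` of the box is conjugate to a ladder loop enclosing `Σ_{κ<μ}|x_κ − lo_κ|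
≤ (d − 1)·D` plaquettes of the box, so the lattice non-abelian Stokes estimate gives `|V_Λ^{ax}(b) − 1| ≤ (d − 1)·D·(B₅M⁵ε)
≤ 100(d − 1)·B₅M⁶ε`; with the input regularity `ε = Kε_k` of Proposition 1 (p. 193 l. 15: `ε = 2L₀^{2N₀}ε_k`, the factor
the typed leaf's docstring lets the `O(1)` absorb — cell GAPS row G-B15-07) this is `Ineq183 dev (100·d·K) B₅ M ε_k`.
Both steps exist in the tree and are used BY NAME: `B8Lemma1NonAbelian.axial_bond_bound_sharp` /
`axial_treeBond_eq_one` with the count `T4AxialGaugeSmallField.l1_lowPart_le'` on the normed `ℤ^d` carrier (§1), and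
`T4AxialGaugeSmallField.dist1_gaugeAct_axialGauge_le_uniform` / `gaugeAct_axialGauge_eq_one` on the torus carrier
`GaugeField P k G` of `Setup` (§2); §3 is the dictionary to the typed leaf; §4 is the NEXT printed sentence, the inference
*"This and (1.83) imply |M^j(U₀) − 1| < O(1)B₃B₅M⁶ε_k inside Λ. (1.84)"* as the triangle inequality it is, with its analytic
input *"|M^j(U₀) − Q^{s*}_{k−j}V_Λ| < 11d²O(1)B₃B₅M⁵ε_k inside Λ, by the estimate (1.80), and (1.65) [14]"* a HYPOTHESIS.

HONEST SCOPE / DEVIATIONS.  (1) `V_Λ` enters only through (1.78): nothing of Proposition 1 (existence, uniqueness,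
minimality, analyticity) is used or asserted; the hypothesis structures below package exactly *"(1.78) on the box Λ^{(k)}
of side ≤ 100M"*.  (2) §1: `U1 𝔸`-valued bond fields in a normed ring (`⊇ U(N)` with the operator norm), `≤`-hypotheses;
§2: any `GaugeGroup` (`dist1`), `Setup.PlaqSmallOn` strict as typed there, box not wrapping around the torus (`D <
sitesPerDir k`; in print `Λ` lies in a cube of size `100M` of a much larger torus).  (3) The constant `100(d − 1)` (stated
as `< 100·d·K`) is this proof's; the print gives none (*"O(1)"*).  (4) §4 proves only the printed implication; its first
input and the transfer of (1.83) from `V_Λ` to `Q^{s*}_{k−j}V_Λ` ([14] (1.65)) are hypotheses, not proved here.  Nothing is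
weakened: the typed leaf is discharged AS TYPED for `dev` = the deviation of an axial-gauge bond variable of `V_Λ`.  Every
declaration is a definition with a body or a proved theorem; nothing of [IV] is asserted as a hypothesis-free fact.  Unit
`lit-balaban-p26` (literature-prover-lit-balaban-p26-g5-0).
-/

noncomputable section

namespace Literature.MathematicalPhysics.QuantumFieldTheory.Balaban1983to89.B15Ineq183AxialGauge

open B7Prop1Explicit B8Lemma1NonAbelian
open T4AxialGaugeSmallField (l1_lowPart_le' boxPlaqs boxBonds castSite axialGauge dist1_gaugeAct_axialGauge_le_uniform
  gaugeAct_axialGauge_eq_one dist1_gaugeAct_axialGauge_le_of_mem_boxBonds)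

/-! ## §0 The arithmetic of the constant: `(d − 1)·D·a ≤ 100(d − 1)K·B₅M⁶ε_k < 100·d·K·B₅M⁶ε_k` -/

/-- The bookkeeping behind *"O(1)B₅M⁶ε_k"*: a deviation bounded by `(d − 1)·D·a` with `D ≤ 100M` (p. 192: *"contained in a
cube of the size 100M"*) and `a ≤ K·B₅M⁵ε_k` (the regularity (1.78) with `ε = Kε_k`) satisfies the typed leaf `Ineq183`
with `C = 100·d·K` (`0 < d`). [cite: Balaban1989LargeFieldI, (1.83) p.197] -/
theorem ineq183_of_le {d D : ℕ} {dev a B₅ M εk K : ℝ} (hdev : dev ≤ ((d - 1 : ℕ) : ℝ) * D * a) (hd : 0 < d)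
    (ha0 : 0 ≤ a) (hK : 0 < K) (hB₅ : 0 < B₅) (hM : 0 < M) (hεk : 0 < εk) (hD : (D : ℝ) ≤ 100 * M)
    (ha : a ≤ K * B₅ * M ^ 5 * εk) : B15.BasicStep.Ineq183 dev (100 * d * K) B₅ M εk := by
  unfold B15.BasicStep.Ineq183
  have hd1 : ((d - 1 : ℕ) : ℝ) < d := by
    have : (d - 1 : ℕ) < d := by omega
    exact_mod_cast this
  have hd0 : (0 : ℝ) ≤ ((d - 1 : ℕ) : ℝ) := Nat.cast_nonneg _
  have hD0 : (0 : ℝ) ≤ D := Nat.cast_nonneg _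
  have hP : 0 < K * (B₅ * M ^ 6 * εk) := by positivity
  calc dev ≤ ((d - 1 : ℕ) : ℝ) * D * a := hdev
    _ ≤ ((d - 1 : ℕ) : ℝ) * (100 * M) * (K * B₅ * M ^ 5 * εk) := by gcongr
    _ = 100 * ((d - 1 : ℕ) : ℝ) * (K * (B₅ * M ^ 6 * εk)) := by ring
    _ < 100 * d * (K * (B₅ * M ^ 6 * εk)) := by nlinarith
    _ = 100 * d * K * B₅ * M ^ 6 * εk := by ring

/-! ## §1 The normed `ℤ^d` carrier (`B7Prop1Explicit` / `B8Lemma1NonAbelian`): (1.78) on the box ⟹ (1.83) in the axial gauge -/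

section Lattice

variable {d : ℕ} {𝔸 : Type*} [NormedRing 𝔸] [NormOneClass 𝔸]

/-- THE PRINTED INPUT OF (1.83) on the normed `ℤ^d` carrier: a `U1`-valued bond field `V` (= `V_Λ = M_k(U₀)` in print) on
the box `Λ^{(k)} = [lo, hi]` of at most `D + 1` sites per direction, whose plaquettes with corners in the box deviate from
`1` by at most `a` (the regularity (1.78) of Proposition 1, `a = B₅M⁵ε`). [cite: Balaban1989LargeFieldI, (1.78) p.194] -/
structure Hyp183 (V : (Fin d → ℤ) → Fin d → 𝔸ˣ) (lo hi : Fin d → ℤ) (D : ℕ) (a : ℝ) : Prop where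
  unit : ∀ x κ, V x κ ∈ U1 𝔸
  width : ∀ κ, hi κ ≤ lo κ + D
  reg : B8Lemma1NonAbelian.PlaqSmall V lo hi a
  nonneg : 0 ≤ a

namespace Hyp183

variable {V : (Fin d → ℤ) → Fin d → 𝔸ˣ} {lo hi : Fin d → ℤ} {D : ℕ} {a : ℝ}

/-- *"We fix for it the axial gauge in Λ^{(k)}"*: the axial-gauge copy `V^{lo} = (axialFn V lo)·V` rooted at the corner is
again `U1`-valued. [cite: Balaban1989LargeFieldI, p.197 l.3] -/
theorem axial_unit (H : Hyp183 V lo hi D a) (x : Fin d → ℤ) (κ : Fin d) : gaugeAct (axialFn V lo) V x κ ∈ U1 𝔸 :=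
  gaugeAct_mem H.unit (axialFn_mem H.unit lo) x κ

/-- … and it IS in the axial gauge: the bonds of the axial tree (those `⟨x, x + e_μ⟩` with `x_κ = lo_κ` for all `κ < μ`)
carry the value `1` exactly (`B8Lemma1NonAbelian.axial_treeBond_eq_one`). [cite: Balaban1989LargeFieldI, p.197 l.3] -/
theorem axial_tree_eq_one (_H : Hyp183 V lo hi D a) {x : Fin d → ℤ} {μ : Fin d} (htree : lowPart μ (x - lo) = 0) :
    gaugeAct (axialFn V lo) V x μ = 1 :=
  axial_treeBond_eq_one V lo x μ htree

/-- **(1.83), explicit form** — *"hence the field V_Λ is small inside Λ^{(k)}"*: in the axial gauge every bond `⟨x, x + e_μ⟩`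
of the box satisfies `‖V_Λ^{ax}(b) − 1‖ ≤ (d − 1)·D·a` (the sharp tree-gauge bound `B8Lemma1NonAbelian.axial_bond_bound_sharp`
with the count `Σ_{κ<μ}|x_κ − lo_κ| ≤ (d − 1)·D` of `T4AxialGaugeSmallField.l1_lowPart_le'`). [cite: Balaban1989LargeFieldI, (1.83) p.197] -/
theorem norm_axial_bond_sub_one_le (H : Hyp183 V lo hi D a) {x : Fin d → ℤ} {μ : Fin d} (hx : lo ≤ x)
    (hxμ : x + e μ ≤ hi) : ‖((gaugeAct (axialFn V lo) V x μ : 𝔸ˣ) : 𝔸) - 1‖ ≤ ((d - 1 : ℕ) : ℝ) * D * a := by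
  refine (axial_bond_bound_sharp V H.unit H.reg lo x μ le_rfl hx hxμ).trans ?_
  have hx' : x ≤ hi := (le_add_of_nonneg_right (e_nonneg μ)).trans hxμ
  have hcount := l1_lowPart_le' μ (sub_nonneg.mpr hx) (n := D) fun κ => by
    have h1 := hx' κ; have h2 := H.width κ; simp only [Pi.sub_apply]; linarith
  exact mul_le_mul_of_nonneg_right (by exact_mod_cast hcount) H.nonneg

/-- **(1.83) BY NAME** on the normed carrier: with `Λ^{(k)}` in a cube of size `100M` (`D ≤ 100M`) and the regularity
`a ≤ K·B₅M⁵ε_k` ((1.78) with `ε = Kε_k`), every axial-gauge bond variable of the box satisfies the typed leaf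
`B15.BasicStep.Ineq183 ‖V_Λ^{ax}(b) − 1‖ (100·d·K) B₅ M ε_k`, i.e. *"|V_Λ(b) − 1| < O(1)B₅M⁶ε_k for b ⊂ Λ^{(k)}"* with
`O(1) = 100·d·K`. [cite: Balaban1989LargeFieldI, (1.83) p.197] -/
theorem ineq183 (H : Hyp183 V lo hi D a) {B₅ M εk K : ℝ} (hK : 0 < K) (hB₅ : 0 < B₅) (hM : 0 < M) (hεk : 0 < εk)
    (hD : (D : ℝ) ≤ 100 * M) (ha : a ≤ K * B₅ * M ^ 5 * εk) {x : Fin d → ℤ} {μ : Fin d} (hx : lo ≤ x)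
    (hxμ : x + e μ ≤ hi) :
    B15.BasicStep.Ineq183 ‖((gaugeAct (axialFn V lo) V x μ : 𝔸ˣ) : 𝔸) - 1‖ (100 * d * K) B₅ M εk :=
  ineq183_of_le (H.norm_axial_bond_sub_one_le hx hxμ) (Fin.pos μ) H.nonneg hK hB₅ hM hεk hD ha

end Hyp183

end Lattice

/-! ## §2 The torus carrier of `Setup` (`GaugeField P k G`, any `GaugeGroup`): the same, via `T4AxialGaugeSmallField` -/

section Torus

variable {P : Params} {k : ℕ} {G : Type*} [GaugeGroup G]

/-- THE PRINTED INPUT OF (1.83) on the torus carrier: a configuration `U` (= `V_Λ` in print) on `T^{(k)}`, a non-wrapping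
box `Λ^{(k)} = castSite '' [lo, hi]` of at most `D + 1` sites per direction (`D < sitesPerDir k`), and the regularity (1.78)
`dist1 (U(∂p′)) < δ` on a set of plaquettes `S₀` containing those of the box (`δ = B₅M⁵ε`). [cite: Balaban1989LargeFieldI, (1.78) p.194] -/
structure Hyp183T (U : GaugeField P k G) (S₀ : Set (Plaq P k)) (lo hi : Fin P.d → ℤ) (D : ℕ) (δ : ℝ) : Prop where
  plaqs : boxPlaqs lo hi ⊆ S₀
  reg : PlaqSmallOn S₀ δ U
  nonneg : 0 ≤ δ
  width : ∀ κ, hi κ ≤ lo κ + D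
  nowrap : D < P.sitesPerDir k

namespace Hyp183T

variable {U : GaugeField P k G} {S₀ : Set (Plaq P k)} {lo hi : Fin P.d → ℤ} {D : ℕ} {δ : ℝ}

/-- The non-wrapping condition in the form `T4AxialGaugeSmallField` uses. [cite: Balaban1989LargeFieldI, (1.73) p.192] -/
theorem extent_lt (H : Hyp183T U S₀ lo hi D δ) (κ : Fin P.d) : hi κ - lo κ < P.sitesPerDir k := by
  have h1 := H.width κ
  have h2 : (D : ℤ) < (P.sitesPerDir k : ℤ) := by exact_mod_cast H.nowrap
  linarith

/-- *"We fix for it the axial gauge in Λ^{(k)}"*: the tree bonds of the box are `= 1` in the gauge `axialGauge U lo hi`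
(`T4AxialGaugeSmallField.gaugeAct_axialGauge_eq_one`). [cite: Balaban1989LargeFieldI, p.197 l.3] -/
theorem axial_tree_eq_one (H : Hyp183T U S₀ lo hi D δ) {x : Fin P.d → ℤ} {μ : Fin P.d} (hx : lo ≤ x)
    (hxμ : x + e μ ≤ hi) (htree : lowPart μ (x - lo) = 0) :
    GaugeField.gaugeAct (axialGauge U lo hi) U ⟨castSite x, μ⟩ = 1 :=
  gaugeAct_axialGauge_eq_one U H.extent_lt hx hxμ htree

/-- **(1.83), explicit form, torus carrier**: every bond `⟨x, x + e_μ⟩` of the box satisfies `dist1 (V_Λ^{ax}(b)) ≤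
(d − 1)·D·δ` (`T4AxialGaugeSmallField.dist1_gaugeAct_axialGauge_le_uniform` BY NAME). [cite: Balaban1989LargeFieldI, (1.83) p.197] -/
theorem dist1_axial_bond_le (H : Hyp183T U S₀ lo hi D δ) {x : Fin P.d → ℤ} {μ : Fin P.d} (hx : lo ≤ x)
    (hxμ : x + e μ ≤ hi) :
    dist1 (GaugeField.gaugeAct (axialGauge U lo hi) U ⟨castSite x, μ⟩) ≤ ((P.d - 1 : ℕ) : ℝ) * D * δ :=
  dist1_gaugeAct_axialGauge_le_uniform U H.plaqs H.reg H.nonneg H.width H.nowrap hx hxμ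

/-- The same for a bond given as an element of `boxBonds lo hi`. [cite: Balaban1989LargeFieldI, (1.83) p.197] -/
theorem dist1_axial_bond_le_of_mem (H : Hyp183T U S₀ lo hi D δ) {b : PBond P k} (hb : b ∈ boxBonds lo hi) :
    dist1 (GaugeField.gaugeAct (axialGauge U lo hi) U b) ≤ ((P.d - 1 : ℕ) : ℝ) * D * δ :=
  dist1_gaugeAct_axialGauge_le_of_mem_boxBonds U H.plaqs H.reg H.nonneg H.width H.nowrap hb

/-- **(1.83) BY NAME** on the torus carrier: with `D ≤ 100M` and `δ ≤ K·B₅M⁵ε_k`, every bond `b` of `Λ^{(k)}` satisfies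
`B15.BasicStep.Ineq183 (dist1 (V_Λ^{ax}(b))) (100·d·K) B₅ M ε_k`. [cite: Balaban1989LargeFieldI, (1.83) p.197] -/
theorem ineq183 (H : Hyp183T U S₀ lo hi D δ) {B₅ M εk K : ℝ} (hK : 0 < K) (hB₅ : 0 < B₅) (hM : 0 < M)
    (hεk : 0 < εk) (hD : (D : ℝ) ≤ 100 * M) (hδ : δ ≤ K * B₅ * M ^ 5 * εk) {b : PBond P k}
    (hb : b ∈ boxBonds lo hi) :
    B15.BasicStep.Ineq183 (dist1 (GaugeField.gaugeAct (axialGauge U lo hi) U b)) (100 * P.d * K) B₅ M εk :=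
  ineq183_of_le (H.dist1_axial_bond_le_of_mem hb) (Fin.pos b.dir) H.nonneg hK hB₅ hM hεk hD hδ

end Hyp183T

end Torus

/-! ## §4 The next sentence: *"This and (1.83) imply |M^j(U₀) − 1| < O(1)B₃B₅M⁶ε_k inside Λ. (1.84)"* -/

section Ineq184

variable {𝔸 : Type*} [NormedRing 𝔸]

/-- **(1.84) from its two printed inputs** (the inference only).  For a bond `b` inside `Λ`, write `W = M^j(U₀)(b)` and
`Q = (Q^{s*}_{k−j}V_Λ)(b)`.  INPUTS (hypotheses, not proved here): *"|M^j(U₀) − Q^{s*}_{k−j}V_Λ| < 11d²O(1)B₃B₅M⁵ε_k inside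
Λ, by the estimate (1.80), and (1.65) [14]"* (`h180`, `O(1) = C₁`) and (1.83) for `Q` (`h183`, `O(1) = C₂`; in print (1.83)
is stated for `V_Λ` and passes to `Q^{s*}_{k−j}V_Λ` by [14] (1.65)).  CONCLUSION: `‖W − 1‖ ≤ ‖W − Q‖ + ‖Q − 1‖ <
(11d²C₁ + C₂)·B₃B₅M⁶ε_k` = the typed leaf `B15.BasicStep.Ineq184 ‖W − 1‖ (11d²C₁ + C₂) B₃ B₅ M ε_k` (absorbing `M⁵ ≤ M⁶`,
`1 ≤ B₃`). [cite: Balaban1989LargeFieldI, (1.84) p.197] -/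
theorem ineq184_of_inputs {d : ℕ} {W Q : 𝔸} {C₁ C₂ B₃ B₅ M εk : ℝ}
    (h180 : ‖W - Q‖ < 11 * (d : ℝ) ^ 2 * C₁ * B₃ * B₅ * M ^ 5 * εk)
    (h183 : B15.BasicStep.Ineq183 ‖Q - 1‖ C₂ B₅ M εk) (hC₂ : 0 ≤ C₂) (hB₃ : 1 ≤ B₃) (hB₅ : 0 ≤ B₅) (hM : 1 ≤ M)
    (hεk : 0 ≤ εk) (hC₁ : 0 ≤ C₁) :
    B15.BasicStep.Ineq184 ‖W - 1‖ (11 * (d : ℝ) ^ 2 * C₁ + C₂) B₃ B₅ M εk := by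
  unfold B15.BasicStep.Ineq184
  unfold B15.BasicStep.Ineq183 at h183
  have htri : ‖W - 1‖ ≤ ‖W - Q‖ + ‖Q - 1‖ := by
    have : W - 1 = (W - Q) + (Q - 1) := by abel
    rw [this]; exact norm_add_le _ _
  have h5 : M ^ 5 ≤ M ^ 6 := pow_le_pow_right₀ hM (by norm_num)
  have hA : 11 * (d : ℝ) ^ 2 * C₁ * B₃ * B₅ * M ^ 5 * εk ≤ 11 * (d : ℝ) ^ 2 * C₁ * B₃ * B₅ * M ^ 6 * εk := by
    have : 0 ≤ 11 * (d : ℝ) ^ 2 * C₁ * B₃ * B₅ := by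
      have : (0 : ℝ) ≤ B₃ := by linarith
      positivity
    exact mul_le_mul_of_nonneg_right (mul_le_mul_of_nonneg_left h5 this) hεk
  have hB : C₂ * B₅ * M ^ 6 * εk ≤ C₂ * B₃ * B₅ * M ^ 6 * εk := by
    have h0 : 0 ≤ C₂ * B₅ * M ^ 6 * εk := by
      have : (0 : ℝ) ≤ M := by linarith
      positivity
    calc C₂ * B₅ * M ^ 6 * εk = 1 * (C₂ * B₅ * M ^ 6 * εk) := by ring
      _ ≤ B₃ * (C₂ * B₅ * M ^ 6 * εk) := mul_le_mul_of_nonneg_right hB₃ h0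
      _ = C₂ * B₃ * B₅ * M ^ 6 * εk := by ring
  calc ‖W - 1‖ ≤ ‖W - Q‖ + ‖Q - 1‖ := htri
    _ < 11 * (d : ℝ) ^ 2 * C₁ * B₃ * B₅ * M ^ 6 * εk + C₂ * B₃ * B₅ * M ^ 6 * εk := by linarith
    _ = (11 * (d : ℝ) ^ 2 * C₁ + C₂) * B₃ * B₅ * M ^ 6 * εk := by ring

end Ineq184

end Literature.MathematicalPhysics.QuantumFieldTheory.Balaban1983to89.B15Ineq183AxialGauge
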